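import Literature.NumberTheory.EllipticCurves.TowerSaturatedAnnihilatorProofs
import Literature.NumberTheory.EllipticCurves.TowerCompatibleFamiliesKonigProofs
import Literature.NumberTheory.GaloisRepresentations.PairingExactAnnihilatorProofs
import HarnessLib

/-!
# Classes orthogonal to the Kummer classes lift to the limit: the duality input (Dual) of the
# descent of exact orthogonal complements, from a perfect level pairing (theorems only)

`Proofs` file in the currency of the tree's abstract towers `Literature.NumberTheory.EllipticCurves.Tower.*`
(no definition, no named fact, no instance, no `sorry`); companion of
`TowerSaturatedAnnihilatorProofs.lean`, whose exactness theorem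
`Tower.mem_levelCondition_of_forall_pairing_eq_zero` takes the hypothesis

  (Dual) a class `y ∈ Y_k` orthogonal to the BOTTOM condition `levelCondition red p ⊥ k` of `X`
  (the level-`k` components of the torsion compatible families — for `X_j = H¹(K_v, T/p^j)` the Kummer
  classes from `H⁰(K_v, A)`) lies in the TOP condition `levelCondition red′ p ⊤ k` of `Y` (is the
  component of a compatible family, i.e. lifts to `lim_j Y_j`).

For the local cohomology towers this is finite-level Tate duality; this file isolates the ALGEBRA:

* §1 partial compatible families through any class (`exists_partial_apply_eq`, by `Function.update`,
  no index casts) and, with Kőnig (`TowerCompatibleFamiliesKonigProofs`), **a class lying in the image of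
  every iterated reduction `red^{(d)} : Y_{k+d} → Y_k` lifts to a compatible family**
  (`mem_levelCondition_top_of_forall_mem_range`; converse `mem_range_redIter_of_mem_levelCondition_top`);
  and `apply_mem_levelCondition_bot_of_compatible` (reduction-compatible maps from a torsion source — the
  Kummer connecting maps — land in the bottom condition: the form in which (Ker) below is discharged);
* §2 **(Dual) from four level inputs** (`mem_levelCondition_top_of_forall_pairing_bot_eq_zero`):
  (Perf) the double-annihilator property of the level-`k` pairing `B_k : X_k × Y_k → Q_k`
  (`T = T^⊥⊥` for subgroups `T ≤ Y_k` — perfectness of the finite level, §3);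
  (Adj) the projection formula `ι_d (B_k (x, red^{(d)} w)) = B_{k+d} (up_d x, w)` for level maps
  `up_d : X_k → X_{k+d}` (`H¹` of `×p^d : T/p^k ↪ T/p^{k+d}`, adjoint to the reduction under the cup
  product) and comparison maps `ι_d : Q_k → Q_{k+d}` of the value groups (`×p^d : R_k(1) ↪ R_{k+d}(1)`,
  or the identity of `ℚ/ℤ`); (Nondeg) left non-degeneracy of `B_{k+d}`; (Ker) `ker up_d ⊆ levelCondition red p ⊥ k` (the
  classes killed by `×p^d` are connecting-map images of `H⁰(K_v, T/p^d)`, i.e. Kummer classes of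
  torsion points — long exact sequence).  Proof: `y ⊥` Kummer classes `⊇ ker up_d = (im red^{(d)})^⊥`
  (Adj + Nondeg), so `y ∈ (im red^{(d)})^⊥⊥ = im red^{(d)}` for every `d`, and §1 applies;
* §3 (Perf) for a pairing of finite `n`-torsion groups into `ℤ/n` with injective adjoints
  (`mem_of_forall_pairing_annihilator_eq_zero`, from the tree's counting lemmas
  `natCard_iInf_ker_flip_mul_natCard₂` / `natCard_iInf_ker_mul_natCard₂`) — apply §2 to `ω ∘ B` for a
  character `ω` making the level pairing perfect (Frobenius form ∘ invariant map);
* §4 the composite with the exactness theorem of the companion file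
  (`mem_levelCondition_of_forall_pairing_eq_zero_of_perfect`).

Cell `pub/bsd-print-x9`, memo `HOME/p1/H4-AT-P-PLAN` (A2)/(A3); nothing arithmetic is proved here; no summit
statement is proved; BSD is not proved by any of this.

References: B. Howard, Compositio Math. 140 (2004), H.4 (arXiv:1202.6340 p. 7, L78–82), Def. 3.2.6;
J. S. Milne, *Arithmetic Duality Theorems* (2006), I §0 Prop. 0.19, I Cor. 2.3 (local Tate duality,
`H¹(K, T/p^k)` self-dual), I Thm. 2.6; B. Mazur, K. Rubin, Mem. AMS 799 (2004), §1.3, Lemma 3.7.1;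
J.-P. Serre, *Galois Cohomology* (1997), I §2.2.
-/

noncomputable section

universe u v w

namespace Literature.NumberTheory.EllipticCurves

open Literature.NumberTheory.GaloisRepresentations

namespace Tower

section Partial

variable {H : ℕ → Type u} [∀ j, AddCommGroup (H j)] (red : ∀ j, H (j + 1) →+ H j)

/-! ## §1 Partial compatible families; liftable classes are those in every image `red^{(d)} (Y_{k+d})` -/

/-- **Every class is the top of a partial compatible family**: for `w ∈ H_k` there is a family compatible
below level `k` with `k`-th component `w` (its successive reductions, assembled with `Function.update`).
[cite: SerreGaloisCohomology1997, Ch. I §2.2 (inverse systems)] -/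
theorem exists_partial_apply_eq (k : ℕ) (w : H k) :
    ∃ x : Π j, H j, (∀ j, j < k → red j (x (j + 1)) = x j) ∧ x k = w := by
  classical
  induction k with
  | zero =>
    exact ⟨Function.update 0 0 w, fun j hj ↦ (Nat.not_lt_zero j hj).elim, Function.update_self _ _ _⟩
  | succ k ih =>
    obtain ⟨x, hx, hxk⟩ := ih (red k w)
    refine ⟨Function.update x (k + 1) w, fun j hj ↦ ?_, Function.update_self _ _ _⟩
    rcases Nat.lt_succ_iff_lt_or_eq.1 hj with hj' | rfl
    · rw [Function.update_of_ne (by omega), Function.update_of_ne (by omega)]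
      exact hx j hj'
    · rw [Function.update_self, Function.update_of_ne (by omega), hxk]

/-- On a family compatible below level `L`, the iterated reduction of the `(i+d)`-component is the
`i`-component whenever `i + d ≤ L`. [cite: SerreGaloisCohomology1997, Ch. I §2.2] -/
theorem redIter_apply_of_partial {L : ℕ} {x : Π j, H j} (hx : ∀ j, j < L → red j (x (j + 1)) = x j)
    (i d : ℕ) (h : i + d ≤ L) : redIter red i d (x (i + d)) = x i := by
  induction d with
  | zero => rfl
  | succ d ih =>
    rw [redIter_succ, show x (i + (d + 1)) = x (i + d + 1) from rfl, hx (i + d) (by omega)]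
    exact ih (by omega)

/-- **A class in the image of every iterated reduction lifts to a compatible family** (tower of finite
groups; Kőnig): if `y ∈ red^{(d)} (H_{k+d})` for every `d` then `y` lies in the TOP condition
`levelCondition red p ⊤ k` (the `k`-th components of `lim_j H_j`).
[cite: SerreGaloisCohomology1997, Ch. I §2.2 (limits of finite groups; compactness)]
[cite: NeukirchSchmidtWingberg2008, Cor. 2.7.6 (Mittag-Leffler)] -/
theorem mem_levelCondition_top_of_forall_mem_range [∀ j, Finite (H j)] (p : ℕ) (k : ℕ) (y : H k)
    (h : ∀ d : ℕ, y ∈ (redIter red k d).range) :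
    y ∈ levelCondition red p (fun _ ↦ (⊤ : AddSubgroup (H _))) k := by
  rw [mem_levelCondition_top_iff]
  refine exists_mem_compatibleFamilies_of_forall_partial red k y fun ℓ ↦ ?_
  obtain ⟨w, hw⟩ := h ℓ
  obtain ⟨x, hx, hxw⟩ := exists_partial_apply_eq red (k + ℓ) w
  refine ⟨x, fun j hj ↦ hx j (by omega), ?_⟩
  rw [← hw, ← hxw]
  exact (redIter_apply_of_partial red hx k ℓ le_rfl).symm

/-- Conversely, a class in the top condition lies in the image of every iterated reduction.
[cite: SerreGaloisCohomology1997, Ch. I §2.2] -/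
theorem mem_range_redIter_of_mem_levelCondition_top (p : ℕ) (k : ℕ) {y : H k}
    (hy : y ∈ levelCondition red p (fun _ ↦ (⊤ : AddSubgroup (H _))) k) (d : ℕ) :
    y ∈ (redIter red k d).range := by
  obtain ⟨x, hx, rfl⟩ := (mem_levelCondition_top_iff red p k y).1 hy
  exact ⟨x (k + d), redIter_apply_of_mem_compatibleFamilies red hx k d⟩


/-- **Compatible systems of maps from a torsion source land in the bottom condition**: if
`δ_j : A₀ → H_j` commute with the reductions (e.g. the Kummer connecting maps `H⁰(K_v, A) → H¹(K_v, T/p^j)`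
of `0 → T/p^j → A → A → 0`), then `δ_k b` lies in `levelCondition red p ⊥ k` for every `b` killed by a power
of `p` — the form in which hypothesis (Ker) of §2 is discharged (`ker (×p^d) = δ (H⁰(K_v, T/p^d))` by the
long exact sequence, and `H⁰(K_v, T/p^d) ⊆ H⁰(K_v, A)` is `p^d`-torsion).
[cite: Howard2004HeegnerKolyvagin, Def. 3.1.2 (arXiv p. 15: propagation from V)] [cite: MilneADT2006, Ch. I Cor. 2.3 (Kummer sequence)] -/
theorem apply_mem_levelCondition_bot_of_compatible {A₀ : Type*} [AddCommGroup A₀] (δ : ∀ j, A₀ →+ H j)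
    (hδ : ∀ j (b : A₀), red j (δ (j + 1) b) = δ j b) (p : ℕ) {b : A₀} {c : ℕ} (hb : p ^ c • b = 0)
    (k : ℕ) : δ k b ∈ levelCondition red p (fun _ ↦ (⊥ : AddSubgroup (H _))) k := by
  refine apply_mem_levelCondition_of_nsmul_eq_zero red p _ (x := fun j ↦ δ j b)
    ((mem_compatibleFamilies_iff red _).2 fun j ↦ hδ j b) (b := c) ?_ k
  funext j
  rw [Pi.smul_apply, Pi.zero_apply, ← map_nsmul, hb, map_zero]

end Partial

/-! ## §2 (Dual): classes orthogonal to the bottom condition lift, from a perfect level pairing -/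

section Dual

variable {X : ℕ → Type u} [∀ j, AddCommGroup (X j)] (red : ∀ j, X (j + 1) →+ X j)
variable {Y : ℕ → Type v} [∀ j, AddCommGroup (Y j)] (red' : ∀ j, Y (j + 1) →+ Y j)
variable {Q : ℕ → Type w} [∀ j, AddCommGroup (Q j)] (B : ∀ j, X j →+ Y j →+ Q j)

/-- **(Dual) from perfectness, the projection formula and the kernel of `×p^d`.**  At a level `k` of two
towers with level pairings `B_j`, suppose: (Perf) every subgroup `T ≤ Y_k` is its own double annihilator
under `B_k` (in the form: `y` pairs to zero with every `x` annihilating `T` ⇒ `y ∈ T`); (Adj)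
`ι_d (B_k (x, red^{(d)} w)) = B_{k+d} (up_d x, w)` for level maps `up_d : X_k → X_{k+d}` and value
comparisons `ι_d : Q_k → Q_{k+d}`; (Nondeg)
`B_{k+d} (x, ·) = 0 ⇒ x = 0`; (Ker) `ker up_d` lies in the bottom condition of `X` (Kummer classes).
Then every `y ∈ Y_k` orthogonal to the bottom condition of `X` lies in the image of every `red^{(d)}`
(`= (ker up_d)^⊥` by Adj/Nondeg/Perf), hence lifts to a compatible family of `Y` (§1, `Y` levelwise
finite).  For `H¹(K_v, T/p^k) × H¹(K_v̄, T/p^k)`: local Tate duality, the cup-product projection formula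
along `T/p^k ↪ T/p^{k+d} ↠ T/p^k`, and the connecting map of `0 → T/p^k → T/p^{k+d} → T/p^d → 0`.
[cite: MilneADT2006, Ch. I §0 Prop. 0.19 and Cor. 2.3] [cite: Howard2004HeegnerKolyvagin, H.4 (arXiv p. 7, L78–82)]
[cite: MazurRubinMemoirs2004, §1.3 and Lemma 3.7.1] -/
theorem mem_levelCondition_top_of_forall_pairing_bot_eq_zero [∀ j, Finite (Y j)] (p : ℕ) (k : ℕ)
    (up : ∀ d : ℕ, X k →+ X (k + d)) (incQ : ∀ d : ℕ, Q k →+ Q (k + d))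
    (hPerf : ∀ (T : AddSubgroup (Y k)) (y : Y k),
      (∀ x : X k, (∀ t ∈ T, B k x t = 0) → B k x y = 0) → y ∈ T)
    (hAdj : ∀ (d : ℕ) (x : X k) (w : Y (k + d)),
      incQ d (B k x (redIter red' k d w)) = B (k + d) (up d x) w)
    (hNondeg : ∀ (d : ℕ) (x : X (k + d)), (∀ w : Y (k + d), B (k + d) x w = 0) → x = 0)
    (hKer : ∀ (d : ℕ) (x : X k), up d x = 0 →
      x ∈ levelCondition red p (fun _ ↦ (⊥ : AddSubgroup (X _))) k)
    (y : Y k) (hy : ∀ x ∈ levelCondition red p (fun _ ↦ (⊥ : AddSubgroup (X _))) k, B k x y = 0) :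
    y ∈ levelCondition red' p (fun _ ↦ (⊤ : AddSubgroup (Y _))) k := by
  refine mem_levelCondition_top_of_forall_mem_range red' p k y fun d ↦ ?_
  refine hPerf (redIter red' k d).range y fun x hx ↦ hy x (hKer d x (hNondeg d (up d x) fun w ↦ ?_))
  rw [← hAdj, hx _ ⟨w, rfl⟩, map_zero]

end Dual

/-! ## §3 (Perf): the double annihilator under a perfect pairing of finite `n`-torsion groups -/

section Perf

variable {Xk Yk : Type*} [AddCommGroup Xk] [AddCommGroup Yk] [Finite Xk] [Finite Yk] {n : ℕ}
  [NeZero n] (b : Xk →+ Yk →+ ZMod n) (hX : ∀ x : Xk, n • x = 0) (hY : ∀ y : Yk, n • y = 0)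
  (hinjL : Function.Injective b) (hinjR : Function.Injective b.flip)

include hX hY hinjL hinjR in
/-- **`T = T^⊥⊥` under a perfect pairing of finite groups**, in the form (Perf) of §2: if `y` pairs to zero
with every `x` in the left annihilator of `T`, then `y ∈ T` (`#T^⊥ · #T = #X = #Y = #T^⊥⊥ · #T^⊥` and
`T ≤ T^⊥⊥`).  Apply with `b = ω ∘ B_k` for a character `ω` of the value group making the level pairing
perfect. [cite: MilneADT2006, Ch. I §0, Prop. 0.19] -/
theorem mem_of_forall_pairing_annihilator_eq_zero (T : AddSubgroup Yk) (y : Yk)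
    (hy : ∀ x : Xk, (∀ t ∈ T, b x t = 0) → b x y = 0) : y ∈ T := by
  have h1 := natCard_iInf_ker_flip_mul_natCard₂ b hX hY hinjL hinjR T
  have h2 := natCard_iInf_ker_mul_natCard₂ b hX hY hinjL hinjR
    (⨅ t ∈ T, (b.flip t).ker : AddSubgroup Xk)
  have hXY := natCard_eq_of_injective_pairing b hX hY hinjL hinjR
  have hle : T ≤ ⨅ s ∈ (⨅ t ∈ T, (b.flip t).ker : AddSubgroup Xk), (b s).ker := fun t ht ↦
    (mem_iInf_ker_iff₂ b _ t).2 fun s hs ↦ (mem_iInf_ker_flip_iff₂ b T s).1 hs t ht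
  have heq : T = ⨅ s ∈ (⨅ t ∈ T, (b.flip t).ker : AddSubgroup Xk), (b s).ker := by
    refine AddSubgroup.eq_of_le_of_card_ge hle ?_
    have hpos : 0 < Nat.card (⨅ t ∈ T, (b.flip t).ker : AddSubgroup Xk) := Nat.card_pos
    rw [← hXY, ← h1, mul_comm (Nat.card (⨅ t ∈ T, (b.flip t).ker : AddSubgroup Xk))] at h2
    exact (Nat.eq_of_mul_eq_mul_right hpos h2).le
  rw [heq]
  exact (mem_iInf_ker_iff₂ b _ y).2 fun s hs ↦ hy s fun t ht ↦ (mem_iInf_ker_flip_iff₂ b T s).1 hs t ht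

end Perf

/-! ## §4 Exactness at level `k` from the perfect level pairings and the limit statement -/

section Composite

variable {X : ℕ → Type u} [∀ j, AddCommGroup (X j)] (red : ∀ j, X (j + 1) →+ X j)
variable {Y : ℕ → Type v} [∀ j, AddCommGroup (Y j)] (red' : ∀ j, Y (j + 1) →+ Y j)
variable {Q : ℕ → Type w} [∀ j, AddCommGroup (Q j)] (B : ∀ j, X j →+ Y j →+ Q j)

/-- **Exactness descends, with (Dual) discharged by §2**: at a level `k` with `n • Y_k = 0`, given (Perf),
(Adj), (Nondeg), (Ker) of §2 and the limit statement (Exact) of the companion file, every `y ∈ Y_k`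
orthogonal to `levelCondition red p C k` lies in `levelCondition red′ p C′ k`.
[cite: Howard2004HeegnerKolyvagin, H.4 and Def. 3.2.6 (arXiv p. 7 L78–82, p. 16)] [cite: MilneADT2006, Ch. I Cor. 2.3]
[cite: MazurRubinMemoirs2004, §1.3 and Lemma 3.7.1] -/
theorem mem_levelCondition_of_forall_pairing_eq_zero_of_perfect [∀ j, Finite (Y j)] (p : ℕ)
    (C : ∀ j, AddSubgroup (X j)) (C' : ∀ j, AddSubgroup (Y j)) (k : ℕ) (n : ℕ)
    (hT : ∀ y : Y k, n • y = 0) (up : ∀ d : ℕ, X k →+ X (k + d))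
    (incQ : ∀ d : ℕ, Q k →+ Q (k + d))
    (hPerf : ∀ (T : AddSubgroup (Y k)) (y : Y k),
      (∀ x : X k, (∀ t ∈ T, B k x t = 0) → B k x y = 0) → y ∈ T)
    (hAdj : ∀ (d : ℕ) (x : X k) (w : Y (k + d)),
      incQ d (B k x (redIter red' k d w)) = B (k + d) (up d x) w)
    (hNondeg : ∀ (d : ℕ) (x : X (k + d)), (∀ w : Y (k + d), B (k + d) x w = 0) → x = 0)
    (hKer : ∀ (d : ℕ) (x : X k), up d x = 0 →
      x ∈ levelCondition red p (fun _ ↦ (⊥ : AddSubgroup (X _))) k)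
    (hExact : ∀ η ∈ compatibleFamilies red', (∀ ξ ∈ saturatedFamilies red p C, B k (ξ k) (η k) = 0) →
      ∃ η' : Π j, Y j, η - n • η' ∈ saturatedFamilies red' p C')
    (y : Y k) (hy : ∀ x ∈ levelCondition red p C k, B k x y = 0) :
    y ∈ levelCondition red' p C' k :=
  mem_levelCondition_of_forall_pairing_eq_zero red red' p C C' k (B k) n hT
    (fun y' hy' ↦ mem_levelCondition_top_of_forall_pairing_bot_eq_zero red red' B p k up incQ hPerf
      hAdj hNondeg hKer y' hy')
    hExact y hy

end Composite

end Tower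

end Literature.NumberTheory.EllipticCurves

end
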